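import Summits.QuantumFields.BalabanUV.Beta.FP.CoarseCovarianceStripProp

/-!
# `BalabanUV.Beta.FP.CoarseCovarianceStripPropCone` — road «FP» (binder row D1), row H′2-IR ∕ IR-2 (ii), file (A) part 2: **the AWAY regime and the
# CONE THEOREM** — for `|Im p_i| ≤ κ₀ = kap0 d`, `|Im p_i| ≤ c₁·redist p` (`c₁ = cone d`) and `0 < redist p = dist∞(Re p, 2πℤ^D)`, the holomorphic
# Feynman matrix `feynC p` of the perfect action is invertible with **`‖PC p α β‖ ≤ CP d / redist p ^ 2`** (`d`-dependent constants only)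

HONEST FRAMING (cell contract, verbatim): «discharging `BetaPertH` makes Bałaban's UV stability UNCONDITIONAL — a real constructive-QFT
result; it is NOT the continuum limit and NOT the Clay problem.»  HONEST DEPENDENCY (verbatim): «continuum YM on T⁴ ⇐ BetaPertH ∧ nine
spine estimates (0/9 proved); BetaPertH ⇐ (D1) ∧ (D4) ∧ CAP+tail; G-an2-4 gates asym, D1 and NE2/3/4.»  THIS MODULE DISCHARGES NOTHING of
D1 ∕ BetaPertH: [folklore] finite-dimensional perturbation theory over part 1, files (W)(F)(M) and the tree's `B4StripCauchy.imLipschitz_of_fat`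
(Cauchy estimates) and `PerfectPropagatorBound.re_quad_feynMat_ge` (REAL-ZONE coercivity of the perfect Feynman matrix, gan24-leaf-05-g34) BY NAME.
No data def; no `def … : Prop`; nothing is cited; 0 sorry.  NOT summit progress; NOT BetaPertH, NOT continuum, NOT Clay.

ABSOLUTE RULE (cell, verbatim): «No internally-minted statement may enter as a cited fact. Every hypothesis is either kernel-proved in this
package or a verbatim quotation of a PUBLISHED theorem with page reference. The manuscript(s) under audit are NOT citable for their own
disputed steps — they are the thing under adjudication; programme-internal (2001/route/tribunal) claims are never citable.»

CONTENT (`D = d+1`; INTENT journal l.22234).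
* §5 `fat_mem`, **`norm_feynC_le_MF`** (`‖feynC q α β‖ ≤ M_F` on `Fat D r_F`), **`feynC_imLipschitz`** (`‖feynC p − feynC (Re p)‖ ≤ (M_F/r_F)·Σ|Im p_i|` on
  `Strip D κ`, `κ ≤ r_F`), `norm_d1C_ofReal_sq` (`‖p̂_a(t)‖² = S₁(t_a)`), **`re_quad_feynC_ofRealVec_ge`** (coercivity `gam d` at a cell point `t` with
  `ρ₀ ≤ ‖t‖∞`), **`PC_bound_away`** (cell, `ρ₀ ≤ ‖Re p‖∞`, `|Im p_i| ≤ κ₀` ⟹ `IsUnit (feynC p).det ∧ ‖PC p α β‖ ≤ 2/gam d`).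
* §6 **`PC_bound_cone`** — THE PERFECT PROPAGATOR SYMBOL ON THE CONE REGION (reduction to the cell by `feynC_wrapC`, then `PC_bound_near` ∕ `PC_bound_away`).
Unit `b2b-balaban-beta-d1-formalise-leaf-06` (gen 7), owner ruling R-FP-21 (A3)∕(C).
-/

noncomputable section

namespace Summit.QuantumFields.BalabanUV.Beta.FP.CoarseCovarianceStripPropCone

open Filter Topology Finset Complex Set Metric Matrix
open scoped BigOperators ComplexConjugate
open Literature.MathematicalPhysics.QuantumFieldTheory.Balaban1983to89
open B4Strip (Strip ofRealVec reVec S1 S1r Delta1 S1r_ge)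
open B4StripCauchy (Fat imLipschitz_of_fat)
open B4ContourShift (BZ)
open B5Prop11Fiber (d1Sym)
open B5Symbol166Strip (kappa166 kappa166_pos)
open Summit.QuantumFields.BalabanUV.Beta.FP.PerfectSymbol166StripReg (bound166 bound166_nonneg)
open Summit.QuantumFields.BalabanUV.Beta.FP.PerfectPropagatorSymbol (quad)
open Summit.QuantumFields.BalabanUV.Beta.FP.PerfectPropagatorBound (re_quad_feynMat_ge)
open Summit.QuantumFields.BalabanUV.Beta.FP.CoarseCovarianceAliasBF (wrapPt wrapPt_eq_self)
open Summit.QuantumFields.BalabanUV.Beta.FP.CoarseCovarianceStripW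
open Summit.QuantumFields.BalabanUV.Beta.FP.CoarseCovarianceStripFeyn
open Summit.QuantumFields.BalabanUV.Beta.FP.CoarseCovarianceStripFeynReg
open Summit.QuantumFields.BalabanUV.Beta.FP.CoarseCovarianceStripMatrix
open Summit.QuantumFields.BalabanUV.Beta.FP.CoarseCovarianceStripProp

variable {d : ℕ}

/-! ## §5 Away from `2πℤ^D`: real coercivity + Lipschitz in `Im p` -/

/-- [folklore] a point of the fat region `Fat D r_F` lies in the periodic strip of width `κ₁₆₆` with every `|Im| < κ₁₆₆`. -/
theorem fat_mem {q : Fin (d + 1) → ℂ} (hq : q ∈ Fat (d + 1) (rF d)) :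
    q ∈ PStrip (d + 1) (kappa166 (d + 1)) ∧ ∀ i, |(q i).im| < kappa166 (d + 1) := by
  have h2 := two_rF_lt d
  exact ⟨fun i => by linarith [(hq i).2], fun i => by linarith [(hq i).2]⟩

/-- [our object] **ENTRY BOUND OF THE FEYNMAN MATRIX ON THE FAT REGION**: `‖feynC q α β‖ ≤ M_F` for `q ∈ Fat D r_F`. -/
theorem norm_feynC_le_MF {q : Fin (d + 1) → ℂ} (hq : q ∈ Fat (d + 1) (rF d)) (α β : Fin (d + 1)) : ‖feynC q α β‖ ≤ MF d := by
  obtain ⟨hP, _⟩ := fat_mem hq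
  have hexp : Real.exp (2 * rF d) + 1 ≤ 4 := by
    have h1 : 2 * rF d ≤ 1 := by linarith [rF_le d]
    have h2 := Real.exp_le_exp.mpr h1
    have h3 : Real.exp 1 < 3 := lt_trans Real.exp_one_lt_d9 (by norm_num)
    linarith
  have him : ∀ a, |(q a).im| ≤ 2 * rF d := fun a => (hq a).2
  have ha : ∀ μ, ‖d1C (-q) μ‖ ≤ 4 := fun μ => by
    have h1 := norm_d1C_neg_le_exp q μ; have h2 := Real.exp_le_exp.mpr (him μ); linarith
  have hb : ∀ μ, ‖d1C q μ‖ ≤ 4 := fun μ => by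
    have h1 := norm_d1C_le_exp q μ; have h2 := Real.exp_le_exp.mpr (him μ); linarith
  have hW : ∀ μ ν, μ ≠ ν → ‖Wper μ ν q‖ ≤ bound166 (d + 1) := fun μ ν _ => norm_Wper_le μ ν hP
  have h1 := norm_exC_le (bound166_nonneg _) (by norm_num) (by norm_num) hW ha hb α β
  have h2 : ‖d1C q α * d1C (-q) β‖ ≤ 16 := by
    rw [norm_mul]; nlinarith [hb α, ha β, norm_nonneg (d1C q α), norm_nonneg (d1C (-q) β)]
  calc ‖feynC q α β‖ ≤ ‖exC (fun μ ν => Wper μ ν q) q α β‖ + ‖d1C q α * d1C (-q) β‖ := norm_add_le _ _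
    _ ≤ 2 * ((d : ℝ) + 1) ^ 2 * bound166 (d + 1) * 4 * 4 + 16 := add_le_add h1 h2
    _ = MF d := by unfold MF; ring

/-- [our object] **THE FEYNMAN MATRIX IS LIPSCHITZ IN `Im p` ON THE BRILLOUIN STRIP OF WIDTH `κ₀`** (Cauchy estimates on `Fat D r_F`):
`‖feynC p α β − feynC (Re p) α β‖ ≤ (M_F/r_F)·Σ_i |Im p_i|`. -/
theorem feynC_imLipschitz {κ : ℝ} (hκ0 : 0 ≤ κ) (hκ : κ ≤ rF d) {p : Fin (d + 1) → ℂ} (hp : p ∈ Strip (d + 1) κ) (α β : Fin (d + 1)) :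
    ‖feynC p α β - feynC (ofRealVec (reVec p)) α β‖ ≤ MF d / rF d * ∑ i, |(p i).im| :=
  imLipschitz_of_fat (fun q => feynC q α β) (rF_pos d) hκ0 hκ
    (fun q hq μ => by
      obtain ⟨hP, hlt⟩ := fat_mem hq
      exact differentiableAt_feynC_update hP μ (hlt μ) α β)
    (fun q hq => norm_feynC_le_MF hq α β) p hp

/-- [folklore] `‖p̂_a(t)‖² = S₁(t_a) = 2 − 2cos t_a` at a real momentum. -/
theorem norm_d1C_ofReal_sq (t : Fin (d + 1) → ℝ) (a : Fin (d + 1)) : ‖d1C (ofRealVec t) a‖ ^ 2 = S1r (t a) := by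
  have h : ((‖d1C (ofRealVec t) a‖ ^ 2 : ℝ) : ℂ) = ((S1r (t a) : ℝ) : ℂ) := by
    rw [PerfectPropagatorSymbol.ofReal_norm_sq_eq, conj_d1C_ofRealVec, ← B4Strip.S1_ofReal]
    have := d1C_neg_mul_d1C (ofRealVec t) a
    rw [this]; rfl
  exact_mod_cast h

/-- [our object] **REAL COERCIVITY OF `feynC` AT A CELL POINT `t` WITH `ρ₀ ≤ ‖t‖∞`**: `γ·Σ‖w‖² ≤ Re quad (feynC (ofRealVec t)) w`. -/
theorem re_quad_feynC_ofRealVec_ge {t : Fin (d + 1) → ℝ} (hcell : ∀ i, t i ∈ Set.Ioc (-Real.pi) Real.pi) (ht : rho0 d ≤ ‖t‖)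
    (w : Fin (d + 1) → ℂ) : gam d * ∑ α, ‖w α‖ ^ 2 ≤ (quad (feynC (ofRealVec t)) w).re := by
  have hBZ : t ∈ BZ (d + 1) := by
    unfold BZ; rw [Set.mem_Icc]; exact ⟨fun i => (hcell i).1.le, fun i => (hcell i).2⟩
  have hw : wrapPt t = t := wrapPt_eq_self (fun i _ => hcell i)
  rw [feynC_ofRealVec, hw]
  have h := re_quad_feynMat_ge hBZ (d1Sym t) w
  refine le_trans ?_ h
  have hph : 4 / Real.pi ^ 2 * rho0 d ^ 2 ≤ ∑ μ, ‖d1Sym t μ‖ ^ 2 := by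
    have e : ∀ μ, ‖d1Sym t μ‖ ^ 2 = S1r (t μ) := fun μ => by rw [← d1C_ofRealVec]; exact norm_d1C_ofReal_sq t μ
    simp only [e]
    have h1 : ∀ μ, 4 * (t μ) ^ 2 / Real.pi ^ 2 ≤ S1r (t μ) := fun μ => S1r_ge (t μ) (abs_le.mpr ⟨(hcell μ).1.le, (hcell μ).2⟩)
    have h2 : ∑ μ, 4 * (t μ) ^ 2 / Real.pi ^ 2 ≤ ∑ μ, S1r (t μ) := Finset.sum_le_sum fun μ _ => h1 μ
    have h3 : ∑ μ, 4 * (t μ) ^ 2 / Real.pi ^ 2 = 4 / Real.pi ^ 2 * ∑ μ, (t μ) ^ 2 := by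
      rw [Finset.mul_sum]; exact Finset.sum_congr rfl fun μ _ => by ring
    have h4 := sq_norm_le_sum_sq t
    have h5 : rho0 d ^ 2 ≤ ‖t‖ ^ 2 := pow_le_pow_left₀ (rho0_pos d).le ht 2
    have h6 : 0 ≤ 4 / Real.pi ^ 2 := by positivity
    nlinarith
  have hsum : 0 ≤ ∑ α, ‖w α‖ ^ 2 := Finset.sum_nonneg fun α _ => sq_nonneg _
  unfold gam
  calc (4 / Real.pi ^ 2) ^ (d + 1 + 2) * (4 / Real.pi ^ 2) * rho0 d ^ 2 * ∑ α, ‖w α‖ ^ 2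
      = (4 / Real.pi ^ 2) ^ (d + 1 + 2) * (4 / Real.pi ^ 2 * rho0 d ^ 2) * ∑ α, ‖w α‖ ^ 2 := by ring
    _ ≤ (4 / Real.pi ^ 2) ^ (d + 1 + 2) * (∑ μ, ‖d1Sym t μ‖ ^ 2) * ∑ α, ‖w α‖ ^ 2 := by gcongr

/-- [our object] **AWAY FROM THE LATTICE**: a cell point `p` with `ρ₀ ≤ ‖Re p‖∞` and `|Im p_i| ≤ κ₀` has `IsUnit (feynC p).det` and
`‖PC p α β‖ ≤ 2/γ`. -/
theorem PC_bound_away {p : Fin (d + 1) → ℂ} (hcell : ∀ i, (p i).re ∈ Set.Ioc (-Real.pi) Real.pi) (hr : rho0 d ≤ ‖reVec p‖)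
    (him : ∀ i, |(p i).im| ≤ kap0 d) : IsUnit (feynC p).det ∧ ∀ α β, ‖PC p α β‖ ≤ 2 / gam d := by
  have hD : (0 : ℝ) < (d : ℝ) + 1 := by positivity
  have hκ := kap0_pos d
  have hp : p ∈ Strip (d + 1) (kap0 d) := fun i => ⟨abs_le.mpr ⟨(hcell i).1.le, (hcell i).2⟩, him i⟩
  -- the perturbation `G := F(p) − F(Re p)`
  set F₀ := feynC (ofRealVec (reVec p)) with hF₀
  set G : Matrix (Fin (d + 1)) (Fin (d + 1)) ℂ := feynC p - F₀ with hG
  have hFG : feynC p = F₀ + G := by rw [hG]; abel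
  have hη : ∀ α β, ‖G α β‖ ≤ MF d / rF d * (((d : ℝ) + 1) * kap0 d) := by
    intro α β
    simp only [hG, Matrix.sub_apply, hF₀]
    refine (feynC_imLipschitz hκ.le (kap0_le_rF d) hp α β).trans ?_
    refine mul_le_mul_of_nonneg_left ?_ (by have := MF_pos d; have := rF_pos d; positivity)
    calc ∑ i, |(p i).im| ≤ ∑ _i : Fin (d + 1), kap0 d := Finset.sum_le_sum fun i _ => him i
      _ = ((d : ℝ) + 1) * kap0 d := by simp only [Finset.sum_const, Finset.card_univ, Fintype.card_fin, nsmul_eq_mul]; push_cast; ring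
  have hcoer0 : ∀ w : Fin (d + 1) → ℂ, gam d * ∑ α, ‖w α‖ ^ 2 ≤ (quad F₀ w).re :=
    fun w => re_quad_feynC_ofRealVec_ge (fun i => by simpa [reVec] using hcell i) hr w
  have hηnn : 0 ≤ MF d / rF d * (((d : ℝ) + 1) * kap0 d) := by have := MF_pos d; have := rF_pos d; positivity
  have hcoer : ∀ w : Fin (d + 1) → ℂ, gam d / 2 * ∑ α, ‖w α‖ ^ 2 ≤ (quad (feynC p) w).re := by
    intro w
    rw [hFG]
    have h := re_quad_add_ge hηnn hcoer0 hη w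
    have hb := kap0_budget d
    have hs : 0 ≤ ∑ α, ‖w α‖ ^ 2 := Finset.sum_nonneg fun α _ => sq_nonneg _
    have : gam d / 2 ≤ gam d - ((d + 1 : ℕ) : ℝ) * (MF d / rF d * (((d : ℝ) + 1) * kap0 d)) := by push_cast; linarith
    nlinarith
  have hγ2 : 0 < gam d / 2 := by have := gam_pos d; linarith
  refine ⟨isUnit_det_of_coercive hγ2 hcoer, fun α β => ?_⟩
  rw [PC]
  refine (norm_inv_entry_le_of_coercive hγ2 hcoer α β).trans (le_of_eq ?_)
  field_simp

/-! ## §6 The cone theorem -/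

/-- [our object] **THE PERFECT PROPAGATOR SYMBOL ON THE CONE REGION** (`d`-dependent constants `κ₀ = kap0 d`, `c₁ = cone d`, `C_P = CP d`):
for every complex momentum `p` with `|Im p_i| ≤ κ₀`, `|Im p_i| ≤ c₁·redist p` (all `i`) and `0 < redist p`,
the holomorphic Feynman matrix is invertible and `‖PC p α β‖ ≤ C_P / redist p ^ 2`. -/
theorem PC_bound_cone {p : Fin (d + 1) → ℂ} (him : ∀ i, |(p i).im| ≤ kap0 d) (hcone : ∀ i, |(p i).im| ≤ cone d * redist p)
    (hpos : 0 < redist p) : IsUnit (feynC p).det ∧ ∀ α β, ‖PC p α β‖ ≤ CP d / redist p ^ 2 := by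
  -- reduce to the cell point `q := wrapC p`
  set q := wrapC p with hq
  have hcell : ∀ i, (q i).re ∈ Set.Ioc (-Real.pi) Real.pi := fun i => wrapRe_re_mem (p i)
  have himq : ∀ i, (q i).im = (p i).im := fun i => wrapRe_im (p i)
  have hrq : redist p = ‖reVec q‖ := rfl
  have hF : feynC p = feynC q := (feynC_wrapC p).symm
  have hPC : PC p = PC q := by rw [PC, PC, hF]
  rw [hF, hPC, hrq]
  rw [hrq] at hcone hpos
  have him' : ∀ i, |(q i).im| ≤ kap0 d := fun i => by rw [himq]; exact him i
  have hcone' : ∀ i, |(q i).im| ≤ cone d * ‖reVec q‖ := fun i => by rw [himq]; exact hcone i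
  have hrπ : ‖reVec q‖ ≤ Real.pi := by rw [← hrq]; exact redist_le_pi p
  have hCP := pi_sq_le_CP d
  by_cases hnear : ‖reVec q‖ ≤ rho0 d
  · obtain ⟨hU, hb⟩ := PC_bound_near hcell hpos hnear hcone'
    refine ⟨hU, fun α β => (hb α β).trans ?_⟩
    exact div_le_div_of_nonneg_right hCP (by positivity)
  · push Not at hnear
    obtain ⟨hU, hb⟩ := PC_bound_away hcell hnear.le him'
    refine ⟨hU, fun α β => (hb α β).trans ?_⟩
    have hr2 : ‖reVec q‖ ^ 2 ≤ Real.pi ^ 2 := pow_le_pow_left₀ (norm_nonneg _) hrπ 2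
    have hg := gam_pos d
    have hr2pos : 0 < ‖reVec q‖ ^ 2 := by positivity
    rw [CP, le_div_iff₀ hr2pos]
    calc 2 / gam d * ‖reVec q‖ ^ 2 ≤ 2 / gam d * Real.pi ^ 2 := mul_le_mul_of_nonneg_left hr2 (by positivity)
      _ = 2 * Real.pi ^ 2 / gam d := by ring

end Summit.QuantumFields.BalabanUV.Beta.FP.CoarseCovarianceStripPropCone

end
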